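import Mathlib
import HarnessLib
import Literature.MathematicalPhysics.QuantumLattice.FramePosKernelL1
import Summits.HubbardSuperconductivity.HubbardSuperconductivity.Theorems.KLProgrammeKLRegimeCountertermMsThresholds
import Summits.HubbardSuperconductivity.HubbardSuperconductivity.Theorems.KLProgrammeH10TwoPointLimitSymbolCellGeometry
import Summits.HubbardSuperconductivity.HubbardSuperconductivity.Theorems.KLProgrammeKLRegimeSplitCounterMap

/-!
# K3 engine child (stmt-HubbardSuperconductivity-19855), stub `stub_engine_scale0`: the admissible frame's sup norm, differences, and the
# INTRINSIC `ℓ¹` size `Σ_z ‖Ǩ_L(z)‖` of its lattice position kernel, from `FrameOK`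

Cell gate-hubbard-kl, seat hubbard-kl-k3c2-p1.  Input (O-θ)(c) of clause (E1-v4)₀ (the smallness `θ < 1` of the determinant-bounded
scale-`0` step runs on the pinned profile `(β/N)·kK`, `kK ≥ Σ_z ‖Ǩ_L(z)‖` — `KLProgrammeKLRegimeEngineScaleZeroNormsL1`) and the `κ = sup|K|`
input of p3's scale-`0` symbol geometry (`HubbardScaleZeroSectorSymbolGeometry`).  From `FrameOK R U N μ K` (the frame is a sum of
`N + 1` pieces with `‖Dʲ(Kp n)‖ ≤ Gfr j · uPow j U · 4^{(j-2)n}`) and k3c3's closed-form allowance sums (`allowanceSum_zero_le`,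
`allowanceSum_one_le` of `…CountertermMsThresholds`):

* `abs_eval_le_of_frameOK` — `|K(p)| ≤ (16/15)·Gfr0·|U|`;
* `abs_eval_sub_le_of_frameOK` — `|K(p + v) - K(p)| ≤ (4/3)·Gfr1·U²·‖v‖₂` (mean value theorem piecewise);
* `abs_eval_second_diff_le_of_frameOK` — `|K(p+v+w) - K(p+v) - K(p+w) + K(p)| ≤ (N+1)·Gfr2·U²·‖v‖₂‖w‖₂` (the order-`2` column does not
  decay along the pieces);
* **`sum_norm_framePosKernel_le_of_frameOK`** — `Σ_z ‖Ǩ_L(z)‖ ≤ 6·((16/15)Gfr0|U| + (π/√2)(4/3)Gfr1U² + (π²/4)Gfr2U²(N+1))` for every `L`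
  (`Literature/…/FramePosKernelL1.sum_norm_framePosKernel_le_of_differences` at step `2π/L`).

Everything is proved; no definitions, no named facts, no sorry.
-/

noncomputable section

namespace Summit.HubbardSuperconductivity.HubbardSuperconductivity.Theorems.EngineV8

set_option linter.dupNamespace false -- summit = problem name (single-conjunct summit), D-0017

open Real Finset Literature.MathematicalPhysics.QuantumLattice Literature.Probability.LatticeModels
open Summit.HubbardSuperconductivity.HubbardSuperconductivity.Theorems.KLRegimeSplit
open Summit.HubbardSuperconductivity.HubbardSuperconductivity.Theorems.TorusFourierL2

/-! ## §1 Mean value bounds on `Momentum` -/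

/-- First differences from the first derivative: `|f(a) - f(b)| ≤ K₁‖a - b‖` when `‖Df‖ ≤ K₁`. -/
theorem abs_sub_le_of_iteratedFDeriv_one {f : Momentum → ℝ} (hf : ContDiff ℝ 1 f) {K₁ : ℝ}
    (hK₁ : ∀ q, ‖iteratedFDeriv ℝ 1 f q‖ ≤ K₁) (a b : Momentum) : |f a - f b| ≤ K₁ * ‖a - b‖ := by
  have hd : ∀ x ∈ (Set.univ : Set Momentum), DifferentiableAt ℝ f x := fun x _ => hf.differentiable (by norm_num) x
  have hb : ∀ x ∈ (Set.univ : Set Momentum), ‖fderiv ℝ f x‖ ≤ K₁ := fun x _ => by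
    rw [← norm_iteratedFDeriv_one]; exact hK₁ x
  have h := Convex.norm_image_sub_le_of_norm_fderiv_le hd hb convex_univ (Set.mem_univ b) (Set.mem_univ a)
  rwa [Real.norm_eq_abs] at h

/-- Mixed second differences from the second derivative: `|f(a+v+w) - f(a+v) - f(a+w) + f(a)| ≤ K₂‖v‖‖w‖` when `‖D²f‖ ≤ K₂`. -/
theorem abs_second_diff_le_of_iteratedFDeriv_two {f : Momentum → ℝ} (hf : ContDiff ℝ 2 f) {K₂ : ℝ}
    (hK₂ : ∀ q, ‖iteratedFDeriv ℝ 2 f q‖ ≤ K₂) (a v w : Momentum) :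
    |f (a + v + w) - f (a + v) - f (a + w) + f a| ≤ K₂ * ‖v‖ * ‖w‖ := by
  set φ : Momentum → ℝ := fun x => f (x + w) - f x with hφ
  have hfd : Differentiable ℝ f := hf.differentiable (by norm_num)
  have hd : ∀ x ∈ (Set.univ : Set Momentum), DifferentiableAt ℝ φ x := fun x _ =>
    ((differentiableAt_comp_add_right w).2 (hfd (x + w))).sub (hfd x)
  have hb : ∀ x ∈ (Set.univ : Set Momentum), ‖fderiv ℝ φ x‖ ≤ K₂ * ‖w‖ := by
    intro x _
    have h1 : fderiv ℝ φ x = fderiv ℝ f (x + w) - fderiv ℝ f x := by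
      rw [hφ, fderiv_fun_sub ((differentiableAt_comp_add_right w).2 (hfd (x + w))) (hfd x), fderiv_comp_add_right]
    rw [h1]
    have h := norm_fderiv_sub_fderiv_le hf hK₂ (x + w) x
    rwa [add_sub_cancel_left] at h
  have h := Convex.norm_image_sub_le_of_norm_fderiv_le hd hb convex_univ (Set.mem_univ a) (Set.mem_univ (a + v))
  rw [Real.norm_eq_abs, add_sub_cancel_left, hφ] at h
  dsimp only at h
  calc |f (a + v + w) - f (a + v) - f (a + w) + f a| = |f (a + v + w) - f (a + v) - (f (a + w) - f a)| := by ring_nf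
    _ ≤ K₂ * ‖w‖ * ‖v‖ := h
    _ = K₂ * ‖v‖ * ‖w‖ := by ring

/-! ## §2 The frame's sup norm and differences from `FrameOK` -/

section Frame

variable {R : RenConsts} {U : ℝ} {N : ℕ} {μ : ℝ} {K : TrigPolyC4v}

/-- A frame value read on `Momentum`: `K(p) = evalM K (toLp 2 p)`. -/
theorem eval_eq_evalM_toLp (A : TrigPolyC4v) (p : Fin 2 → ℝ) : A.eval p = evalM A (WithLp.toLp 2 p) := by
  rw [evalM_apply, WithLp.ofLp_toLp]

/-- **`sup|K| ≤ (16/15)·Gfr0·|U|`** on an admissible frame. -/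
theorem abs_eval_le_of_frameOK (hK : FrameOK R U N μ K) (hR : ∀ j, 0 ≤ R.Gfr j) (p : Fin 2 → ℝ) :
    |K.eval p| ≤ 16 / 15 * (R.Gfr 0 * |U|) := by
  obtain ⟨Kp, hsum, hb⟩ := hK.2
  rw [hsum p]
  refine (abs_sum_le_sum_abs _ _).trans ((sum_le_sum fun n hn => ?_).trans (allowanceSum_zero_le hR U N))
  have hn' : n ≤ N := Nat.lt_succ_iff.1 (mem_range.1 hn)
  have h := hb n hn' 0 (by norm_num) (WithLp.toLp 2 p)
  rw [norm_iteratedFDeriv_zero, Real.norm_eq_abs, ← eval_eq_evalM_toLp] at h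
  exact h

/-- **First differences**: `|K(p + v) - K(p)| ≤ (4/3)·Gfr1·U²·‖v‖₂`. -/
theorem abs_eval_sub_le_of_frameOK (hK : FrameOK R U N μ K) (hR : ∀ j, 0 ≤ R.Gfr j) (p v : Fin 2 → ℝ) :
    |K.eval (p + v) - K.eval p| ≤ 4 / 3 * (R.Gfr 1 * U ^ 2) * ‖WithLp.toLp 2 v‖ := by
  obtain ⟨Kp, hsum, hb⟩ := hK.2
  rw [hsum (p + v), hsum p, ← sum_sub_distrib]
  have hv0 : 0 ≤ ‖WithLp.toLp 2 v‖ := norm_nonneg _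
  refine (abs_sum_le_sum_abs _ _).trans ?_
  have hpt : ∀ n ∈ range (N + 1), |(Kp n).eval (p + v) - (Kp n).eval p| ≤
      R.Gfr 1 * uPow 1 U * (4 : ℝ) ^ (((1 : ℤ) - 2) * n) * ‖WithLp.toLp 2 v‖ := by
    intro n hn
    have hn' : n ≤ N := Nat.lt_succ_iff.1 (mem_range.1 hn)
    rw [eval_eq_evalM_toLp, eval_eq_evalM_toLp, WithLp.toLp_add]
    have h := abs_sub_le_of_iteratedFDeriv_one ((contDiff_evalM (Kp n)).of_le le_top)
      (fun q => hb n hn' 1 (by norm_num) q) (WithLp.toLp 2 p + WithLp.toLp 2 v) (WithLp.toLp 2 p)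
    rwa [add_sub_cancel_left] at h
  calc ∑ n ∈ range (N + 1), |(Kp n).eval (p + v) - (Kp n).eval p|
      ≤ ∑ n ∈ range (N + 1), R.Gfr 1 * uPow 1 U * (4 : ℝ) ^ (((1 : ℤ) - 2) * n) * ‖WithLp.toLp 2 v‖ := sum_le_sum hpt
    _ = (∑ n ∈ range (N + 1), R.Gfr 1 * uPow 1 U * (4 : ℝ) ^ (((1 : ℤ) - 2) * n)) * ‖WithLp.toLp 2 v‖ := by
        rw [sum_mul]
    _ ≤ 4 / 3 * (R.Gfr 1 * U ^ 2) * ‖WithLp.toLp 2 v‖ := mul_le_mul_of_nonneg_right (allowanceSum_one_le hR U N) hv0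

/-- **Mixed second differences**: `|K(p+v+w) - K(p+v) - K(p+w) + K(p)| ≤ (N+1)·Gfr2·U²·‖v‖₂‖w‖₂`. -/
theorem abs_eval_second_diff_le_of_frameOK (hK : FrameOK R U N μ K) (p v w : Fin 2 → ℝ) :
    |K.eval (p + v + w) - K.eval (p + v) - K.eval (p + w) + K.eval p| ≤
      ((N : ℝ) + 1) * (R.Gfr 2 * U ^ 2) * (‖WithLp.toLp 2 v‖ * ‖WithLp.toLp 2 w‖) := by
  obtain ⟨Kp, hsum, hb⟩ := hK.2
  have hsplit : K.eval (p + v + w) - K.eval (p + v) - K.eval (p + w) + K.eval p =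
      ∑ n ∈ range (N + 1), ((Kp n).eval (p + v + w) - (Kp n).eval (p + v) - (Kp n).eval (p + w) + (Kp n).eval p) := by
    rw [hsum (p + v + w), hsum (p + v), hsum (p + w), hsum p]
    simp only [sum_add_distrib, sum_sub_distrib]
  rw [hsplit]
  have hvw : 0 ≤ ‖WithLp.toLp 2 v‖ * ‖WithLp.toLp 2 w‖ := by positivity
  refine (abs_sum_le_sum_abs _ _).trans ?_
  have hpt : ∀ n ∈ range (N + 1), |(Kp n).eval (p + v + w) - (Kp n).eval (p + v) - (Kp n).eval (p + w) + (Kp n).eval p| ≤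
      R.Gfr 2 * U ^ 2 * (‖WithLp.toLp 2 v‖ * ‖WithLp.toLp 2 w‖) := by
    intro n hn
    have hn' : n ≤ N := Nat.lt_succ_iff.1 (mem_range.1 hn)
    simp only [eval_eq_evalM_toLp, WithLp.toLp_add]
    have hK₂ : ∀ q, ‖iteratedFDeriv ℝ 2 (evalM (Kp n)) q‖ ≤ R.Gfr 2 * U ^ 2 := by
      intro q
      have h := hb n hn' 2 (by norm_num) q
      rwa [show ((2 : ℕ) : ℤ) - 2 = 0 by norm_num, zero_mul, zpow_zero, mul_one, show uPow 2 U = U ^ 2 from uPow_succ 1 U] at h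
    have h := abs_second_diff_le_of_iteratedFDeriv_two ((contDiff_evalM (Kp n)).of_le le_top) hK₂
      (WithLp.toLp 2 p) (WithLp.toLp 2 v) (WithLp.toLp 2 w)
    calc _ ≤ R.Gfr 2 * U ^ 2 * ‖WithLp.toLp 2 v‖ * ‖WithLp.toLp 2 w‖ := h
      _ = _ := by ring
  calc ∑ n ∈ range (N + 1), |(Kp n).eval (p + v + w) - (Kp n).eval (p + v) - (Kp n).eval (p + w) + (Kp n).eval p|
      ≤ ∑ n ∈ range (N + 1), R.Gfr 2 * U ^ 2 * (‖WithLp.toLp 2 v‖ * ‖WithLp.toLp 2 w‖) := sum_le_sum hpt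
    _ = ((N : ℝ) + 1) * (R.Gfr 2 * U ^ 2) * (‖WithLp.toLp 2 v‖ * ‖WithLp.toLp 2 w‖) := by
        rw [sum_const, card_range, nsmul_eq_mul]
        push_cast
        ring

/-! ## §3 The intrinsic `ℓ¹` size of the lattice position kernel of an admissible frame -/

/-- The Euclidean length of the step `(2π/L)e_j`. -/
theorem norm_toLp_smul_single (c : ℝ) (j : Fin 2) :
    ‖WithLp.toLp 2 (c • (Pi.single j (1 : ℝ) : Fin 2 → ℝ))‖ = |c| := by
  rw [WithLp.toLp_smul, norm_smul, Real.norm_eq_abs]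
  have : WithLp.toLp 2 (Pi.single j (1 : ℝ) : Fin 2 → ℝ) = PiLp.single 2 j (1 : ℝ) := rfl
  rw [this, PiLp.norm_single, norm_one, mul_one]

/-- `√(a² + b² + c²) ≤ a + b + c` for `a, b, c ≥ 0`. -/
theorem sqrt_sq_add_sq_add_sq_le {a b c : ℝ} (ha : 0 ≤ a) (hb : 0 ≤ b) (hc : 0 ≤ c) :
    Real.sqrt (a ^ 2 + b ^ 2 + c ^ 2) ≤ a + b + c := by
  calc Real.sqrt (a ^ 2 + b ^ 2 + c ^ 2) ≤ Real.sqrt ((a + b + c) ^ 2) :=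
        Real.sqrt_le_sqrt (by nlinarith [mul_nonneg ha hb, mul_nonneg ha hc, mul_nonneg hb hc])
    _ = a + b + c := Real.sqrt_sq (by positivity)

/-- **`Σ_z ‖Ǩ_L(z)‖ ≤ 6·((16/15)Gfr0|U| + (π/√2)(4/3)Gfr1U² + (π²/4)Gfr2U²(N+1))`** for every admissible frame and every `L` — the
eval-determined size that replaces `coeffNorm 0 K` in the scale-`0` determinant-bound profile. -/
theorem sum_norm_framePosKernel_le_of_frameOK {L : ℕ} [NeZero L] (hK : FrameOK R U N μ K) (hR : ∀ j, 0 ≤ R.Gfr j) :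
    ∑ z : TorusSite 2 L, ‖framePosKernel L K z‖ ≤
      6 * (16 / 15 * (R.Gfr 0 * |U|) + Real.pi / Real.sqrt 2 * (4 / 3 * (R.Gfr 1 * U ^ 2)) +
        Real.pi ^ 2 / 4 * (((N : ℝ) + 1) * (R.Gfr 2 * U ^ 2))) := by
  have hL : (0 : ℝ) < L := Nat.cast_pos.2 (Nat.pos_of_ne_zero (NeZero.ne L))
  have hπ := Real.pi_pos
  have hstep : ‖WithLp.toLp 2 ((2 * Real.pi / L) • (Pi.single (0 : Fin 2) (1 : ℝ) : Fin 2 → ℝ))‖ = 2 * Real.pi / L ∧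
      ‖WithLp.toLp 2 ((2 * Real.pi / L) • (Pi.single (1 : Fin 2) (1 : ℝ) : Fin 2 → ℝ))‖ = 2 * Real.pi / L := by
    refine ⟨?_, ?_⟩ <;> rw [norm_toLp_smul_single, abs_of_pos (by positivity)]
  have hstepj : ∀ j : Fin 2, ‖WithLp.toLp 2 ((2 * Real.pi / L) • (Pi.single j (1 : ℝ) : Fin 2 → ℝ))‖ = 2 * Real.pi / L := fun j => by
    rw [norm_toLp_smul_single, abs_of_pos (by positivity)]
  set S₀ : ℝ := 16 / 15 * (R.Gfr 0 * |U|) with hS₀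
  set A₁ : ℝ := 4 / 3 * (R.Gfr 1 * U ^ 2) with hA₁
  set A₂ : ℝ := ((N : ℝ) + 1) * (R.Gfr 2 * U ^ 2) with hA₂
  have hS₀0 : 0 ≤ S₀ := by rw [hS₀]; have := hR 0; positivity
  have hA₁0 : 0 ≤ A₁ := by rw [hA₁]; have := hR 1; positivity
  have hA₂0 : 0 ≤ A₂ := by rw [hA₂]; have := hR 2; positivity
  have h := sum_norm_framePosKernel_le_of_differences (L := L) K (S₀ := S₀) (D₁ := A₁ * (2 * Real.pi / L))
    (D₂ := A₂ * ((2 * Real.pi / L) * (2 * Real.pi / L))) (abs_eval_le_of_frameOK hK hR)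
    (fun p j => by
      have h1 := abs_eval_sub_le_of_frameOK hK hR p ((2 * Real.pi / L) • (Pi.single j (1 : ℝ) : Fin 2 → ℝ))
      rwa [hstepj j] at h1)
    (fun p => by
      have h2 := abs_eval_second_diff_le_of_frameOK hK p ((2 * Real.pi / L) • (Pi.single (0 : Fin 2) (1 : ℝ) : Fin 2 → ℝ))
        ((2 * Real.pi / L) • (Pi.single (1 : Fin 2) (1 : ℝ) : Fin 2 → ℝ))
      rwa [hstep.1, hstep.2] at h2)
  refine h.trans ?_
  refine mul_le_mul_of_nonneg_left ?_ (by norm_num)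
  -- `√(S₀² + L²D₁²/8 + L⁴D₂²/256) ≤ S₀ + LD₁/(2√2) + L²D₂/16`
  have hsq2 : (0 : ℝ) < Real.sqrt 2 := Real.sqrt_pos.2 (by norm_num)
  have hsq2sq : Real.sqrt 2 ^ 2 = 2 := Real.sq_sqrt (by norm_num)
  have hb : (L : ℝ) ^ 2 / 8 * (A₁ * (2 * Real.pi / L)) ^ 2 = (Real.pi / Real.sqrt 2 * A₁) ^ 2 := by
    field_simp
    rw [hsq2sq]
    ring
  have hc : (L : ℝ) ^ 4 / 256 * (A₂ * ((2 * Real.pi / L) * (2 * Real.pi / L))) ^ 2 = (Real.pi ^ 2 / 4 * A₂) ^ 2 := by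
    field_simp
    ring
  rw [hb, hc]
  exact sqrt_sq_add_sq_add_sq_le hS₀0 (by positivity) (by positivity)

end Frame

end Summit.HubbardSuperconductivity.HubbardSuperconductivity.Theorems.EngineV8

end
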